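import Summits.QuantumFields.BalabanUV.Beta.GAN24.FourFaceGaugeSectors

/-!
# `BalabanUV.Beta.GAN24.FourFaceGaugeSectorsTriple` — binder row G-an2-4 ∕ (CONV-C), row (C) at the levels `j ≥ 1`, CONTACT side; Part 6 of
# `GAN24/FourFaceGaugeSectors`: **THE FOUR TRIPLE CLASSES AND THE ALL-EQUAL CLASS OF THE SECTOR EXPANSION** — three slots facing one direction and the fourth another:
# `N⁴·FF = zmode + (the three pairs inside the triple) − (the triple)`; all four slots facing one direction: the alternating sum over the twelve subsets of size `≠ 1`

NOT IN PRINT; OUR BOOKKEEPING (G-an2-4 crux team (2), leaf prover `b2b-balaban-gan24-formalise-leaf-02`, gen 64).  With Part 2 (two pairs) and Part 5 (one pair, all distinct)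
this completes the class table of the sector expansion over the fifteen set partitions of the four slots — every pattern `(μ,ν;α,β)` of (C)sym's binder falls in one class.
[folklore] `decide` + Part 1's `sector_eq_zero_of_lonely` + `Finset.sum_subset`; generic `d`, `1 ≤ N`, `Y` as in Part 1; 0 `def`, 0 cited facts, 0 `def … : Prop`,
0 sorry.  HONEST FRAMING (cell contract, verbatim): «discharging `BetaPertH` makes Bałaban's UV stability UNCONDITIONAL — a real constructive-QFT result; it is NOT the
continuum limit and NOT the Clay problem.»  HONEST DEPENDENCY (verbatim): «continuum YM on T⁴ ⇐ BetaPertH ∧ nine spine estimates (0/9 proved); BetaPertH ⇐ (D1) ∧ (D4) ∧ CAP+tail;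
G-an2-4 gates asym, D1 and NE2/3/4.»  Bookkeeping only: NO Ward content; discharges NOTHING of (C) ∕ (C)sym ∕ (Q-L) ∕ «T2Shape» ∕ «T2Drift» ∕ (hW, hWall); NEVER «G-an2-4 closed»
as (CONV-C); NOT D1, NOT BetaPertH, NOT continuum, NOT Clay.  2026-08-23.
-/

noncomputable section

open Finset
open scoped BigOperators
open Literature.MathematicalPhysics.QuantumFieldTheory
open Literature.MathematicalPhysics.QuantumFieldTheory.Balaban1983to89
open Literature.MathematicalPhysics.QuantumFieldTheory.Balaban1983to89.Beta
open ExpKernelCalculus (MKer shiftK)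
open OneStepResolventKernel (Fib)
open AffineAveraging (Site box toSite)
open BalabanCompositeJets (LocStencil₂)
open Summit.QuantumFields.BalabanUV.Beta.GAN24.BiStencilZeroMode (Tab zmode)
open Summit.QuantumFields.BalabanUV.Beta.GAN24.FourFaceGaugeSectors (fourFace_mul_eq_sum_sectors sector_empty sector_eq_zero_of_lonely)

namespace Summit.QuantumFields.BalabanUV.Beta.GAN24.FourFaceGaugeSectorsTriple

variable {d : ℕ} {N : ℕ}

/-! ## §1 The four triple classes: `N⁴·FF = zmode + Σ_{pairs ⊂ triple} Sector − Sector_{triple}` -/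

/-- [folklore] The lonely members of the triple class `0, 0, 0, 1`: outside `{∅, {0, 1}, {0, 2}, {1, 2}, {0, 1, 2}}` every subset has a member alone in its class. -/
theorem lonely_of_triple_012 : ∀ S : Finset (Fin 4), S ∉ ({∅, {0, 1}, {0, 2}, {1, 2}, {0, 1, 2}} : Finset (Finset (Fin 4))) →
    ∃ s₀ ∈ S, ∀ s ∈ S, (![0, 0, 0, 1] : Fin 4 → Fin 2) s = (![0, 0, 0, 1] : Fin 4 → Fin 2) s₀ → s = s₀ := by
  decide

/-- [folklore] In the class `(κ,κ;κ,a)` (`κ ≠ a`) two slots face the same direction iff they have the same class label. -/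
theorem class_of_dir_triple_012 {κ a : Fin (d + 1)} (hκa : κ ≠ a) (s s₀ : Fin 4)
    (h : (![κ, κ, κ, a] : Fin 4 → Fin (d + 1)) s = (![κ, κ, κ, a] : Fin 4 → Fin (d + 1)) s₀) :
    (![0, 0, 0, 1] : Fin 4 → Fin 2) s = (![0, 0, 0, 1] : Fin 4 → Fin 2) s₀ := by
  fin_cases s <;> fin_cases s₀ <;> simp [hκa, hκa.symm] at h ⊢

/-- NOT IN PRINT; OUR BOOKKEEPING.  **THE TRIPLE CLASS `(κ,κ;κ,a)`** (`κ ≠ a`; `Y` as in Part 1): `N⁴·FF_N(Y)(κ,κ;κ,a) = zmode N Y κ κ (inl α) (inl β) + Sector_{{0, 1}} + Sector_{{0, 2}}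
+ Sector_{{1, 2}} − Sector_{{0, 1, 2}}` — the three pairs inside the triple and (with sign `(−1)³`) the triple survive; the eleven other sectors are lonely. -/
theorem fourFace_mul_eq_of_triple_012 (hN : 1 ≤ N) {Y : Tab d} {C δ : ℝ} (hY : LocStencil₂ Y C δ) (hδ : 0 < δ)
    (h1 : ∀ κ u κ' u' (t x z : Site (d + 1)) (α β : Fin (d + 1)),
      Y κ (u + t) κ' (u' + t) x z (Sum.inl α) (Sum.inl β) = shiftK (-t) (Y κ u κ' u') x z (Sum.inl α) (Sum.inl β))
    {κ a : Fin (d + 1)} (hκa : κ ≠ a) (α β : Fin (d + 1)) :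
    (N : ℝ) ^ 4 * ∑ rr ∈ box (d + 1) N, ∑' u' : Site (d + 1), ∑' x : Site (d + 1), ∑' z : Site (d + 1),
        (if toSite rr κ % (N : ℤ) = (N : ℤ) - 1 ∧ u' κ % (N : ℤ) = (N : ℤ) - 1 ∧ x κ % (N : ℤ) = (N : ℤ) - 1 ∧ z a % (N : ℤ) = (N : ℤ) - 1
          then Y κ (toSite rr) κ u' x z (Sum.inl α) (Sum.inl β) else 0)
      = zmode N Y κ κ (Sum.inl α) (Sum.inl β)
        + ∑ rr ∈ box (d + 1) N, ∑' u' : Site (d + 1), ∑' x : Site (d + 1), ∑' z : Site (d + 1),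
            (∏ s ∈ ({0, 1} : Finset (Fin 4)), (1 - (N : ℝ) * (if (![toSite rr, u', x, z] : Fin 4 → Site (d + 1)) s ((![κ, κ, κ, a] : Fin 4 → Fin (d + 1)) s) % (N : ℤ) = (N : ℤ) - 1
              then (1 : ℝ) else 0))) * Y κ (toSite rr) κ u' x z (Sum.inl α) (Sum.inl β)
        + ∑ rr ∈ box (d + 1) N, ∑' u' : Site (d + 1), ∑' x : Site (d + 1), ∑' z : Site (d + 1),
            (∏ s ∈ ({0, 2} : Finset (Fin 4)), (1 - (N : ℝ) * (if (![toSite rr, u', x, z] : Fin 4 → Site (d + 1)) s ((![κ, κ, κ, a] : Fin 4 → Fin (d + 1)) s) % (N : ℤ) = (N : ℤ) - 1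
              then (1 : ℝ) else 0))) * Y κ (toSite rr) κ u' x z (Sum.inl α) (Sum.inl β)
        + ∑ rr ∈ box (d + 1) N, ∑' u' : Site (d + 1), ∑' x : Site (d + 1), ∑' z : Site (d + 1),
            (∏ s ∈ ({1, 2} : Finset (Fin 4)), (1 - (N : ℝ) * (if (![toSite rr, u', x, z] : Fin 4 → Site (d + 1)) s ((![κ, κ, κ, a] : Fin 4 → Fin (d + 1)) s) % (N : ℤ) = (N : ℤ) - 1
              then (1 : ℝ) else 0))) * Y κ (toSite rr) κ u' x z (Sum.inl α) (Sum.inl β)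
        - ∑ rr ∈ box (d + 1) N, ∑' u' : Site (d + 1), ∑' x : Site (d + 1), ∑' z : Site (d + 1),
            (∏ s ∈ ({0, 1, 2} : Finset (Fin 4)), (1 - (N : ℝ) * (if (![toSite rr, u', x, z] : Fin 4 → Site (d + 1)) s ((![κ, κ, κ, a] : Fin 4 → Fin (d + 1)) s) % (N : ℤ) = (N : ℤ) - 1
              then (1 : ℝ) else 0))) * Y κ (toSite rr) κ u' x z (Sum.inl α) (Sum.inl β) := by
  rw [fourFace_mul_eq_sum_sectors hN hY hδ h1 κ κ κ a α β,
    ← Finset.sum_subset (s₁ := ({∅, {0, 1}, {0, 2}, {1, 2}, {0, 1, 2}} : Finset (Finset (Fin 4)))) (fun S _ => Finset.mem_powerset.2 (Finset.subset_univ S)) ?van]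
  · rw [Finset.sum_insert (by decide), Finset.sum_insert (by decide), Finset.sum_insert (by decide), Finset.sum_insert (by decide),
      Finset.sum_singleton, sector_empty]
    have c01 : (({0, 1} : Finset (Fin 4)).card : ℕ) = 2 := by decide
    have c02 : (({0, 2} : Finset (Fin 4)).card : ℕ) = 2 := by decide
    have c12 : (({1, 2} : Finset (Fin 4)).card : ℕ) = 2 := by decide
    have c3 : (({0, 1, 2} : Finset (Fin 4)).card : ℕ) = 3 := by decide
    rw [Finset.card_empty, c01, c02, c12, c3, pow_zero, neg_one_sq, show ((-1 : ℝ)) ^ 3 = -1 by norm_num]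
    simp only [one_mul, neg_one_mul, add_assoc, sub_eq_add_neg]
  · intro S _ hS
    obtain ⟨s₀, hs₀, hl⟩ := lonely_of_triple_012 S hS
    rw [sector_eq_zero_of_lonely hN hY hδ h1 κ κ κ a α β S hs₀ (fun s hs h => hl s hs (class_of_dir_triple_012 hκa s s₀ h)), mul_zero]

/-- [folklore] The lonely members of the triple class `0, 0, 1, 0`: outside `{∅, {0, 1}, {0, 3}, {1, 3}, {0, 1, 3}}` every subset has a member alone in its class. -/
theorem lonely_of_triple_013 : ∀ S : Finset (Fin 4), S ∉ ({∅, {0, 1}, {0, 3}, {1, 3}, {0, 1, 3}} : Finset (Finset (Fin 4))) →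
    ∃ s₀ ∈ S, ∀ s ∈ S, (![0, 0, 1, 0] : Fin 4 → Fin 2) s = (![0, 0, 1, 0] : Fin 4 → Fin 2) s₀ → s = s₀ := by
  decide

/-- [folklore] In the class `(κ,κ;a,κ)` (`κ ≠ a`) two slots face the same direction iff they have the same class label. -/
theorem class_of_dir_triple_013 {κ a : Fin (d + 1)} (hκa : κ ≠ a) (s s₀ : Fin 4)
    (h : (![κ, κ, a, κ] : Fin 4 → Fin (d + 1)) s = (![κ, κ, a, κ] : Fin 4 → Fin (d + 1)) s₀) :
    (![0, 0, 1, 0] : Fin 4 → Fin 2) s = (![0, 0, 1, 0] : Fin 4 → Fin 2) s₀ := by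
  fin_cases s <;> fin_cases s₀ <;> simp [hκa, hκa.symm] at h ⊢

/-- NOT IN PRINT; OUR BOOKKEEPING.  **THE TRIPLE CLASS `(κ,κ;a,κ)`** (`κ ≠ a`; `Y` as in Part 1): `N⁴·FF_N(Y)(κ,κ;a,κ) = zmode N Y κ κ (inl α) (inl β) + Sector_{{0, 1}} + Sector_{{0, 3}}
+ Sector_{{1, 3}} − Sector_{{0, 1, 3}}` — the three pairs inside the triple and (with sign `(−1)³`) the triple survive; the eleven other sectors are lonely. -/
theorem fourFace_mul_eq_of_triple_013 (hN : 1 ≤ N) {Y : Tab d} {C δ : ℝ} (hY : LocStencil₂ Y C δ) (hδ : 0 < δ)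
    (h1 : ∀ κ u κ' u' (t x z : Site (d + 1)) (α β : Fin (d + 1)),
      Y κ (u + t) κ' (u' + t) x z (Sum.inl α) (Sum.inl β) = shiftK (-t) (Y κ u κ' u') x z (Sum.inl α) (Sum.inl β))
    {κ a : Fin (d + 1)} (hκa : κ ≠ a) (α β : Fin (d + 1)) :
    (N : ℝ) ^ 4 * ∑ rr ∈ box (d + 1) N, ∑' u' : Site (d + 1), ∑' x : Site (d + 1), ∑' z : Site (d + 1),
        (if toSite rr κ % (N : ℤ) = (N : ℤ) - 1 ∧ u' κ % (N : ℤ) = (N : ℤ) - 1 ∧ x a % (N : ℤ) = (N : ℤ) - 1 ∧ z κ % (N : ℤ) = (N : ℤ) - 1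
          then Y κ (toSite rr) κ u' x z (Sum.inl α) (Sum.inl β) else 0)
      = zmode N Y κ κ (Sum.inl α) (Sum.inl β)
        + ∑ rr ∈ box (d + 1) N, ∑' u' : Site (d + 1), ∑' x : Site (d + 1), ∑' z : Site (d + 1),
            (∏ s ∈ ({0, 1} : Finset (Fin 4)), (1 - (N : ℝ) * (if (![toSite rr, u', x, z] : Fin 4 → Site (d + 1)) s ((![κ, κ, a, κ] : Fin 4 → Fin (d + 1)) s) % (N : ℤ) = (N : ℤ) - 1
              then (1 : ℝ) else 0))) * Y κ (toSite rr) κ u' x z (Sum.inl α) (Sum.inl β)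
        + ∑ rr ∈ box (d + 1) N, ∑' u' : Site (d + 1), ∑' x : Site (d + 1), ∑' z : Site (d + 1),
            (∏ s ∈ ({0, 3} : Finset (Fin 4)), (1 - (N : ℝ) * (if (![toSite rr, u', x, z] : Fin 4 → Site (d + 1)) s ((![κ, κ, a, κ] : Fin 4 → Fin (d + 1)) s) % (N : ℤ) = (N : ℤ) - 1
              then (1 : ℝ) else 0))) * Y κ (toSite rr) κ u' x z (Sum.inl α) (Sum.inl β)
        + ∑ rr ∈ box (d + 1) N, ∑' u' : Site (d + 1), ∑' x : Site (d + 1), ∑' z : Site (d + 1),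
            (∏ s ∈ ({1, 3} : Finset (Fin 4)), (1 - (N : ℝ) * (if (![toSite rr, u', x, z] : Fin 4 → Site (d + 1)) s ((![κ, κ, a, κ] : Fin 4 → Fin (d + 1)) s) % (N : ℤ) = (N : ℤ) - 1
              then (1 : ℝ) else 0))) * Y κ (toSite rr) κ u' x z (Sum.inl α) (Sum.inl β)
        - ∑ rr ∈ box (d + 1) N, ∑' u' : Site (d + 1), ∑' x : Site (d + 1), ∑' z : Site (d + 1),
            (∏ s ∈ ({0, 1, 3} : Finset (Fin 4)), (1 - (N : ℝ) * (if (![toSite rr, u', x, z] : Fin 4 → Site (d + 1)) s ((![κ, κ, a, κ] : Fin 4 → Fin (d + 1)) s) % (N : ℤ) = (N : ℤ) - 1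
              then (1 : ℝ) else 0))) * Y κ (toSite rr) κ u' x z (Sum.inl α) (Sum.inl β) := by
  rw [fourFace_mul_eq_sum_sectors hN hY hδ h1 κ κ a κ α β,
    ← Finset.sum_subset (s₁ := ({∅, {0, 1}, {0, 3}, {1, 3}, {0, 1, 3}} : Finset (Finset (Fin 4)))) (fun S _ => Finset.mem_powerset.2 (Finset.subset_univ S)) ?van]
  · rw [Finset.sum_insert (by decide), Finset.sum_insert (by decide), Finset.sum_insert (by decide), Finset.sum_insert (by decide),
      Finset.sum_singleton, sector_empty]
    have c01 : (({0, 1} : Finset (Fin 4)).card : ℕ) = 2 := by decide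
    have c02 : (({0, 3} : Finset (Fin 4)).card : ℕ) = 2 := by decide
    have c12 : (({1, 3} : Finset (Fin 4)).card : ℕ) = 2 := by decide
    have c3 : (({0, 1, 3} : Finset (Fin 4)).card : ℕ) = 3 := by decide
    rw [Finset.card_empty, c01, c02, c12, c3, pow_zero, neg_one_sq, show ((-1 : ℝ)) ^ 3 = -1 by norm_num]
    simp only [one_mul, neg_one_mul, add_assoc, sub_eq_add_neg]
  · intro S _ hS
    obtain ⟨s₀, hs₀, hl⟩ := lonely_of_triple_013 S hS
    rw [sector_eq_zero_of_lonely hN hY hδ h1 κ κ a κ α β S hs₀ (fun s hs h => hl s hs (class_of_dir_triple_013 hκa s s₀ h)), mul_zero]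

/-- [folklore] The lonely members of the triple class `0, 1, 0, 0`: outside `{∅, {0, 2}, {0, 3}, {2, 3}, {0, 2, 3}}` every subset has a member alone in its class. -/
theorem lonely_of_triple_023 : ∀ S : Finset (Fin 4), S ∉ ({∅, {0, 2}, {0, 3}, {2, 3}, {0, 2, 3}} : Finset (Finset (Fin 4))) →
    ∃ s₀ ∈ S, ∀ s ∈ S, (![0, 1, 0, 0] : Fin 4 → Fin 2) s = (![0, 1, 0, 0] : Fin 4 → Fin 2) s₀ → s = s₀ := by
  decide

/-- [folklore] In the class `(κ,a;κ,κ)` (`κ ≠ a`) two slots face the same direction iff they have the same class label. -/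
theorem class_of_dir_triple_023 {κ a : Fin (d + 1)} (hκa : κ ≠ a) (s s₀ : Fin 4)
    (h : (![κ, a, κ, κ] : Fin 4 → Fin (d + 1)) s = (![κ, a, κ, κ] : Fin 4 → Fin (d + 1)) s₀) :
    (![0, 1, 0, 0] : Fin 4 → Fin 2) s = (![0, 1, 0, 0] : Fin 4 → Fin 2) s₀ := by
  fin_cases s <;> fin_cases s₀ <;> simp [hκa, hκa.symm] at h ⊢

/-- NOT IN PRINT; OUR BOOKKEEPING.  **THE TRIPLE CLASS `(κ,a;κ,κ)`** (`κ ≠ a`; `Y` as in Part 1): `N⁴·FF_N(Y)(κ,a;κ,κ) = zmode N Y κ a (inl α) (inl β) + Sector_{{0, 2}} + Sector_{{0, 3}}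
+ Sector_{{2, 3}} − Sector_{{0, 2, 3}}` — the three pairs inside the triple and (with sign `(−1)³`) the triple survive; the eleven other sectors are lonely. -/
theorem fourFace_mul_eq_of_triple_023 (hN : 1 ≤ N) {Y : Tab d} {C δ : ℝ} (hY : LocStencil₂ Y C δ) (hδ : 0 < δ)
    (h1 : ∀ κ u κ' u' (t x z : Site (d + 1)) (α β : Fin (d + 1)),
      Y κ (u + t) κ' (u' + t) x z (Sum.inl α) (Sum.inl β) = shiftK (-t) (Y κ u κ' u') x z (Sum.inl α) (Sum.inl β))
    {κ a : Fin (d + 1)} (hκa : κ ≠ a) (α β : Fin (d + 1)) :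
    (N : ℝ) ^ 4 * ∑ rr ∈ box (d + 1) N, ∑' u' : Site (d + 1), ∑' x : Site (d + 1), ∑' z : Site (d + 1),
        (if toSite rr κ % (N : ℤ) = (N : ℤ) - 1 ∧ u' a % (N : ℤ) = (N : ℤ) - 1 ∧ x κ % (N : ℤ) = (N : ℤ) - 1 ∧ z κ % (N : ℤ) = (N : ℤ) - 1
          then Y κ (toSite rr) a u' x z (Sum.inl α) (Sum.inl β) else 0)
      = zmode N Y κ a (Sum.inl α) (Sum.inl β)
        + ∑ rr ∈ box (d + 1) N, ∑' u' : Site (d + 1), ∑' x : Site (d + 1), ∑' z : Site (d + 1),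
            (∏ s ∈ ({0, 2} : Finset (Fin 4)), (1 - (N : ℝ) * (if (![toSite rr, u', x, z] : Fin 4 → Site (d + 1)) s ((![κ, a, κ, κ] : Fin 4 → Fin (d + 1)) s) % (N : ℤ) = (N : ℤ) - 1
              then (1 : ℝ) else 0))) * Y κ (toSite rr) a u' x z (Sum.inl α) (Sum.inl β)
        + ∑ rr ∈ box (d + 1) N, ∑' u' : Site (d + 1), ∑' x : Site (d + 1), ∑' z : Site (d + 1),
            (∏ s ∈ ({0, 3} : Finset (Fin 4)), (1 - (N : ℝ) * (if (![toSite rr, u', x, z] : Fin 4 → Site (d + 1)) s ((![κ, a, κ, κ] : Fin 4 → Fin (d + 1)) s) % (N : ℤ) = (N : ℤ) - 1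
              then (1 : ℝ) else 0))) * Y κ (toSite rr) a u' x z (Sum.inl α) (Sum.inl β)
        + ∑ rr ∈ box (d + 1) N, ∑' u' : Site (d + 1), ∑' x : Site (d + 1), ∑' z : Site (d + 1),
            (∏ s ∈ ({2, 3} : Finset (Fin 4)), (1 - (N : ℝ) * (if (![toSite rr, u', x, z] : Fin 4 → Site (d + 1)) s ((![κ, a, κ, κ] : Fin 4 → Fin (d + 1)) s) % (N : ℤ) = (N : ℤ) - 1
              then (1 : ℝ) else 0))) * Y κ (toSite rr) a u' x z (Sum.inl α) (Sum.inl β)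
        - ∑ rr ∈ box (d + 1) N, ∑' u' : Site (d + 1), ∑' x : Site (d + 1), ∑' z : Site (d + 1),
            (∏ s ∈ ({0, 2, 3} : Finset (Fin 4)), (1 - (N : ℝ) * (if (![toSite rr, u', x, z] : Fin 4 → Site (d + 1)) s ((![κ, a, κ, κ] : Fin 4 → Fin (d + 1)) s) % (N : ℤ) = (N : ℤ) - 1
              then (1 : ℝ) else 0))) * Y κ (toSite rr) a u' x z (Sum.inl α) (Sum.inl β) := by
  rw [fourFace_mul_eq_sum_sectors hN hY hδ h1 κ a κ κ α β,
    ← Finset.sum_subset (s₁ := ({∅, {0, 2}, {0, 3}, {2, 3}, {0, 2, 3}} : Finset (Finset (Fin 4)))) (fun S _ => Finset.mem_powerset.2 (Finset.subset_univ S)) ?van]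
  · rw [Finset.sum_insert (by decide), Finset.sum_insert (by decide), Finset.sum_insert (by decide), Finset.sum_insert (by decide),
      Finset.sum_singleton, sector_empty]
    have c01 : (({0, 2} : Finset (Fin 4)).card : ℕ) = 2 := by decide
    have c02 : (({0, 3} : Finset (Fin 4)).card : ℕ) = 2 := by decide
    have c12 : (({2, 3} : Finset (Fin 4)).card : ℕ) = 2 := by decide
    have c3 : (({0, 2, 3} : Finset (Fin 4)).card : ℕ) = 3 := by decide
    rw [Finset.card_empty, c01, c02, c12, c3, pow_zero, neg_one_sq, show ((-1 : ℝ)) ^ 3 = -1 by norm_num]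
    simp only [one_mul, neg_one_mul, add_assoc, sub_eq_add_neg]
  · intro S _ hS
    obtain ⟨s₀, hs₀, hl⟩ := lonely_of_triple_023 S hS
    rw [sector_eq_zero_of_lonely hN hY hδ h1 κ a κ κ α β S hs₀ (fun s hs h => hl s hs (class_of_dir_triple_023 hκa s s₀ h)), mul_zero]

/-- [folklore] The lonely members of the triple class `1, 0, 0, 0`: outside `{∅, {1, 2}, {1, 3}, {2, 3}, {1, 2, 3}}` every subset has a member alone in its class. -/
theorem lonely_of_triple_123 : ∀ S : Finset (Fin 4), S ∉ ({∅, {1, 2}, {1, 3}, {2, 3}, {1, 2, 3}} : Finset (Finset (Fin 4))) →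
    ∃ s₀ ∈ S, ∀ s ∈ S, (![1, 0, 0, 0] : Fin 4 → Fin 2) s = (![1, 0, 0, 0] : Fin 4 → Fin 2) s₀ → s = s₀ := by
  decide

/-- [folklore] In the class `(a,κ;κ,κ)` (`κ ≠ a`) two slots face the same direction iff they have the same class label. -/
theorem class_of_dir_triple_123 {κ a : Fin (d + 1)} (hκa : κ ≠ a) (s s₀ : Fin 4)
    (h : (![a, κ, κ, κ] : Fin 4 → Fin (d + 1)) s = (![a, κ, κ, κ] : Fin 4 → Fin (d + 1)) s₀) :
    (![1, 0, 0, 0] : Fin 4 → Fin 2) s = (![1, 0, 0, 0] : Fin 4 → Fin 2) s₀ := by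
  fin_cases s <;> fin_cases s₀ <;> simp [hκa, hκa.symm] at h ⊢

/-- NOT IN PRINT; OUR BOOKKEEPING.  **THE TRIPLE CLASS `(a,κ;κ,κ)`** (`κ ≠ a`; `Y` as in Part 1): `N⁴·FF_N(Y)(a,κ;κ,κ) = zmode N Y a κ (inl α) (inl β) + Sector_{{1, 2}} + Sector_{{1, 3}}
+ Sector_{{2, 3}} − Sector_{{1, 2, 3}}` — the three pairs inside the triple and (with sign `(−1)³`) the triple survive; the eleven other sectors are lonely. -/
theorem fourFace_mul_eq_of_triple_123 (hN : 1 ≤ N) {Y : Tab d} {C δ : ℝ} (hY : LocStencil₂ Y C δ) (hδ : 0 < δ)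
    (h1 : ∀ κ u κ' u' (t x z : Site (d + 1)) (α β : Fin (d + 1)),
      Y κ (u + t) κ' (u' + t) x z (Sum.inl α) (Sum.inl β) = shiftK (-t) (Y κ u κ' u') x z (Sum.inl α) (Sum.inl β))
    {κ a : Fin (d + 1)} (hκa : κ ≠ a) (α β : Fin (d + 1)) :
    (N : ℝ) ^ 4 * ∑ rr ∈ box (d + 1) N, ∑' u' : Site (d + 1), ∑' x : Site (d + 1), ∑' z : Site (d + 1),
        (if toSite rr a % (N : ℤ) = (N : ℤ) - 1 ∧ u' κ % (N : ℤ) = (N : ℤ) - 1 ∧ x κ % (N : ℤ) = (N : ℤ) - 1 ∧ z κ % (N : ℤ) = (N : ℤ) - 1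
          then Y a (toSite rr) κ u' x z (Sum.inl α) (Sum.inl β) else 0)
      = zmode N Y a κ (Sum.inl α) (Sum.inl β)
        + ∑ rr ∈ box (d + 1) N, ∑' u' : Site (d + 1), ∑' x : Site (d + 1), ∑' z : Site (d + 1),
            (∏ s ∈ ({1, 2} : Finset (Fin 4)), (1 - (N : ℝ) * (if (![toSite rr, u', x, z] : Fin 4 → Site (d + 1)) s ((![a, κ, κ, κ] : Fin 4 → Fin (d + 1)) s) % (N : ℤ) = (N : ℤ) - 1
              then (1 : ℝ) else 0))) * Y a (toSite rr) κ u' x z (Sum.inl α) (Sum.inl β)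
        + ∑ rr ∈ box (d + 1) N, ∑' u' : Site (d + 1), ∑' x : Site (d + 1), ∑' z : Site (d + 1),
            (∏ s ∈ ({1, 3} : Finset (Fin 4)), (1 - (N : ℝ) * (if (![toSite rr, u', x, z] : Fin 4 → Site (d + 1)) s ((![a, κ, κ, κ] : Fin 4 → Fin (d + 1)) s) % (N : ℤ) = (N : ℤ) - 1
              then (1 : ℝ) else 0))) * Y a (toSite rr) κ u' x z (Sum.inl α) (Sum.inl β)
        + ∑ rr ∈ box (d + 1) N, ∑' u' : Site (d + 1), ∑' x : Site (d + 1), ∑' z : Site (d + 1),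
            (∏ s ∈ ({2, 3} : Finset (Fin 4)), (1 - (N : ℝ) * (if (![toSite rr, u', x, z] : Fin 4 → Site (d + 1)) s ((![a, κ, κ, κ] : Fin 4 → Fin (d + 1)) s) % (N : ℤ) = (N : ℤ) - 1
              then (1 : ℝ) else 0))) * Y a (toSite rr) κ u' x z (Sum.inl α) (Sum.inl β)
        - ∑ rr ∈ box (d + 1) N, ∑' u' : Site (d + 1), ∑' x : Site (d + 1), ∑' z : Site (d + 1),
            (∏ s ∈ ({1, 2, 3} : Finset (Fin 4)), (1 - (N : ℝ) * (if (![toSite rr, u', x, z] : Fin 4 → Site (d + 1)) s ((![a, κ, κ, κ] : Fin 4 → Fin (d + 1)) s) % (N : ℤ) = (N : ℤ) - 1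
              then (1 : ℝ) else 0))) * Y a (toSite rr) κ u' x z (Sum.inl α) (Sum.inl β) := by
  rw [fourFace_mul_eq_sum_sectors hN hY hδ h1 a κ κ κ α β,
    ← Finset.sum_subset (s₁ := ({∅, {1, 2}, {1, 3}, {2, 3}, {1, 2, 3}} : Finset (Finset (Fin 4)))) (fun S _ => Finset.mem_powerset.2 (Finset.subset_univ S)) ?van]
  · rw [Finset.sum_insert (by decide), Finset.sum_insert (by decide), Finset.sum_insert (by decide), Finset.sum_insert (by decide),
      Finset.sum_singleton, sector_empty]
    have c01 : (({1, 2} : Finset (Fin 4)).card : ℕ) = 2 := by decide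
    have c02 : (({1, 3} : Finset (Fin 4)).card : ℕ) = 2 := by decide
    have c12 : (({2, 3} : Finset (Fin 4)).card : ℕ) = 2 := by decide
    have c3 : (({1, 2, 3} : Finset (Fin 4)).card : ℕ) = 3 := by decide
    rw [Finset.card_empty, c01, c02, c12, c3, pow_zero, neg_one_sq, show ((-1 : ℝ)) ^ 3 = -1 by norm_num]
    simp only [one_mul, neg_one_mul, add_assoc, sub_eq_add_neg]
  · intro S _ hS
    obtain ⟨s₀, hs₀, hl⟩ := lonely_of_triple_123 S hS
    rw [sector_eq_zero_of_lonely hN hY hδ h1 a κ κ κ α β S hs₀ (fun s hs h => hl s hs (class_of_dir_triple_123 hκa s s₀ h)), mul_zero]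

/-! ## §2 The all-equal class: the alternating sum over the subsets of size `≠ 1` -/

/-- NOT IN PRINT; OUR BOOKKEEPING.  **THE ALL-EQUAL CLASS `(κ,κ;κ,κ)`** (`Y` as in Part 1): the four one-insertion sectors are lonely, nothing else is —
`N⁴·FF_N(Y)(κ,κ;κ,κ) = Σ_{S ⊆ Fin 4, |S| ≠ 1} (−1)^{|S|}·Sector_S(Y)` (the empty set, six pairs, four triples, the quadruple). -/
theorem fourFace_mul_eq_of_allEqual (hN : 1 ≤ N) {Y : Tab d} {C δ : ℝ} (hY : LocStencil₂ Y C δ) (hδ : 0 < δ)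
    (h1 : ∀ κ u κ' u' (t x z : Site (d + 1)) (α β : Fin (d + 1)),
      Y κ (u + t) κ' (u' + t) x z (Sum.inl α) (Sum.inl β) = shiftK (-t) (Y κ u κ' u') x z (Sum.inl α) (Sum.inl β))
    (κ α β : Fin (d + 1)) :
    (N : ℝ) ^ 4 * ∑ rr ∈ box (d + 1) N, ∑' u' : Site (d + 1), ∑' x : Site (d + 1), ∑' z : Site (d + 1),
        (if toSite rr κ % (N : ℤ) = (N : ℤ) - 1 ∧ u' κ % (N : ℤ) = (N : ℤ) - 1 ∧ x κ % (N : ℤ) = (N : ℤ) - 1 ∧ z κ % (N : ℤ) = (N : ℤ) - 1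
          then Y κ (toSite rr) κ u' x z (Sum.inl α) (Sum.inl β) else 0)
      = ∑ S ∈ (Finset.univ : Finset (Fin 4)).powerset with S.card ≠ 1, (-1 : ℝ) ^ S.card *
          ∑ rr ∈ box (d + 1) N, ∑' u' : Site (d + 1), ∑' x : Site (d + 1), ∑' z : Site (d + 1),
            (∏ s ∈ S, (1 - (N : ℝ) * (if (![toSite rr, u', x, z] : Fin 4 → Site (d + 1)) s ((![κ, κ, κ, κ] : Fin 4 → Fin (d + 1)) s) % (N : ℤ) = (N : ℤ) - 1
              then (1 : ℝ) else 0))) * Y κ (toSite rr) κ u' x z (Sum.inl α) (Sum.inl β) := by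
  rw [fourFace_mul_eq_sum_sectors hN hY hδ h1 κ κ κ κ α β,
    ← Finset.sum_subset (s₁ := (Finset.univ : Finset (Fin 4)).powerset.filter (fun S => S.card ≠ 1)) (fun S _ => Finset.mem_powerset.2 (Finset.subset_univ S)) ?van]
  intro S _ hS
  have hc : S.card = 1 := by
    by_contra hne
    exact hS (Finset.mem_filter.2 ⟨Finset.mem_powerset.2 (Finset.subset_univ S), hne⟩)
  obtain ⟨s₀, rfl⟩ := Finset.card_eq_one.1 hc
  rw [sector_eq_zero_of_lonely hN hY hδ h1 κ κ κ κ α β {s₀} (Finset.mem_singleton_self s₀)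
    (fun s hs _ => Finset.mem_singleton.1 hs), mul_zero]

end Summit.QuantumFields.BalabanUV.Beta.GAN24.FourFaceGaugeSectorsTriple
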